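import Mathlib
import Literature.NumberTheory.LFunctions.StepanovHasseDeriv
import HarnessLib

/-!
# Stepanov's theorem for `y² = f(x)`: Schmidt, Ch. I, Theorem 2A (`d = 2`) — PROVED from Lemma 3B

Topic `NumberTheory/LFunctions`.  W. M. Schmidt, *Equations over Finite Fields. An Elementary
Approach*, LNM 536 (1976), Ch. I §2 (the counts `N = N₀ + 2N₁`, `q = N₀ + N₁ + N₂`, p. 14) and
§4 "Proof of the Main Theorem" (pp. 19–20), for the hyperelliptic case `d = 2`: given the
Fundamental lemma 3B (proved in `StepanovAuxPoly` as `Stepanov.lemma3B`; here it enters as the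
hypothesis `H3B`, verbatim), we PROVE

* `card_solutions_eq`, `sum_quadraticChar_eval_eq`, `card_classes_eq`, `card_frakS` — the §2/§4
  bookkeeping: `N = q + Σ_x χ(f(x)) = N₀ + 2N₁`, `q = N₀ + N₁ + N₂`, `|𝔖_θ| = N₀ + N_θ`;
* `abs_sub_mul_le_of_auxPolys` — `|N − q|·M ≤ 8mq` from the two auxiliary polynomials
  (`θ = ±1`) via "`|𝔖| M ≤ deg r`" ((4.1), (4.2));
* `sqrt_sub_three_bounds`, `real_bound_of_mul_le` — the choice `M = [√q] − 3` and
  `|N − q| ≤ 8mq/M ≤ 4·2^{3/2} m q^{1/2}`;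
* `card_solutions_C_mul_sq`, `card_solutions_C_mul_nonsquare`, `card_solutions_taylor`,
  `card_solutions_of_char_two` — the reductions to `f` monic with `f(0) ≠ 0` and `q` odd;
* `theorem_I_2A_two_of_lemma3B` — **Theorem 2A for `d = 2`**: for every finite field `F` and
  `f ∈ F[X]` not of the form `c·ℓ²` with `q > 100·2·(deg f)²`,
  `|#{(x, y) : y² = f(x)} − q| ≤ 4·2^{3/2}·deg f·q^{1/2}` — exactly the tree's named fact
  `Literature.NumberTheory.LFunctions.Schmidt1976.theorem_I_2A_two` (`KloostermanWeilViaStepanov`), whose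
  discharge `theorem_I_2A_two_holds` is the one-line combination with `Stepanov.lemma3B`.

## References

* W. M. Schmidt, *Equations over Finite Fields. An Elementary Approach*, Lecture Notes in
  Math. 536, Springer (1976), Ch. I §2 Theorem 2A, Lemmas 2C, 2D, p. 11–14; §4 pp. 19–20; §5 p. 22.
* S. A. Stepanov, *On the number of points of a hyperelliptic curve over a finite prime field*,
  Izv. Akad. Nauk SSSR Ser. Mat. 33 (1969) 1171–1181.
-/

noncomputable section

open Finset Polynomial

namespace Literature.NumberTheory.LFunctions

namespace Stepanov

variable {F : Type*} [Field F] [Fintype F] [DecidableEq F]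

/-! ### §2: the number of solutions via Euler's criterion -/

/-- `#{y : y² = a} = χ(a) + 1` (`χ` the quadratic character, `q` odd). [folklore] -/
theorem card_filter_sq_eq (hF : ringChar F ≠ 2) (a : F) :
    ((univ.filter fun y : F => y ^ 2 = a).card : ℤ) = quadraticChar F a + 1 := by
  have h := quadraticChar_card_sqrts hF a
  rw [Set.toFinset_setOf] at h
  convert h using 3

/-- `N = Σ_x #{y : y² = f(x)} = q + Σ_x χ(f(x))` (Schmidt I §2: "`N = N₀ + d N₁`" bookkeeping, `d = 2`).
[cite: Schmidt1976, Ch. I §2, p. 14] -/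
theorem card_solutions_eq (hF : ringChar F ≠ 2) (f : F[X]) :
    ((univ.filter fun xy : F × F => xy.2 ^ 2 = f.eval xy.1).card : ℤ) =
      Fintype.card F + ∑ x : F, quadraticChar F (f.eval x) := by
  rw [Finset.card_filter, Fintype.sum_prod_type]
  push_cast
  have : ∀ x : F, (∑ y : F, if (x, y).2 ^ 2 = f.eval (x, y).1 then (1 : ℤ) else 0) =
      quadraticChar F (f.eval x) + 1 := by
    intro x
    rw [← card_filter_sq_eq hF (f.eval x), Finset.card_filter]
    push_cast
    rfl
  rw [Finset.sum_congr rfl fun x _ => this x, Finset.sum_add_distrib, Finset.sum_const,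
    Finset.card_univ, nsmul_eq_mul, mul_one, add_comm]

/-- `Σ_x χ(f(x)) = N₁ − N₂` with `N₁ = #{x : f(x) ≠ 0, f(x)^{(q−1)/2} = 1}`,
`N₂ = #{x : f(x) ≠ 0, f(x)^{(q−1)/2} = −1}` (Schmidt I §2, Euler's criterion via Lemma 2D).
[cite: Schmidt1976, Ch. I §2, p. 14] -/
theorem sum_quadraticChar_eval_eq (hF : ringChar F ≠ 2) (f : F[X]) :
    ∑ x : F, quadraticChar F (f.eval x) =
      ((univ.filter fun x : F => f.eval x ≠ 0 ∧ f.eval x ^ (Fintype.card F / 2) = 1).card : ℤ) -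
      ((univ.filter fun x : F => f.eval x ≠ 0 ∧ f.eval x ^ (Fintype.card F / 2) = -1).card : ℤ) := by
  have hne : (-1 : F) ≠ 1 := Ring.neg_one_ne_one_of_char_ne_two hF
  have hne' : (1 : F) ≠ -1 := fun h => hne h.symm
  rw [Finset.card_filter, Finset.card_filter]
  push_cast
  rw [← Finset.sum_sub_distrib]
  refine Finset.sum_congr rfl fun x _ => ?_
  by_cases hx : f.eval x = 0
  · simp [hx]
  · rw [quadraticChar_eq_pow_of_char_ne_two hF hx]
    rcases FiniteField.pow_dichotomy hF hx with h1 | h1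
    · simp [hx, h1, hne']
    · simp [hx, h1, hne]

/-- `N₀ + N₁ + N₂ = q` ("every element of `F_q` is a root of one and only one of the factors of
`Z^q − Z`", Schmidt I §2, p. 14). [cite: Schmidt1976, Ch. I §2, p. 14] -/
theorem card_classes_eq (hF : ringChar F ≠ 2) (f : F[X]) :
    (univ.filter fun x : F => f.eval x = 0).card +
      (univ.filter fun x : F => f.eval x ≠ 0 ∧ f.eval x ^ (Fintype.card F / 2) = 1).card +
      (univ.filter fun x : F => f.eval x ≠ 0 ∧ f.eval x ^ (Fintype.card F / 2) = -1).card =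
        Fintype.card F := by
  rw [Finset.card_filter, Finset.card_filter, Finset.card_filter, ← Finset.sum_add_distrib,
    ← Finset.sum_add_distrib, ← Finset.card_univ, Finset.card_eq_sum_ones]
  have hne : (-1 : F) ≠ 1 := Ring.neg_one_ne_one_of_char_ne_two hF
  have hne' : (1 : F) ≠ -1 := fun h => hne h.symm
  refine Finset.sum_congr rfl fun x _ => ?_
  by_cases hx : f.eval x = 0
  · simp [hx]
  · rcases FiniteField.pow_dichotomy hF hx with h1 | h1
    · simp [hx, h1, hne']
    · simp [hx, h1, hne]

/-- The set `𝔖_θ = {x : f(x) = 0 or g(x) = θ}` of Lemma 3B (`θ = ±1`, `g = f^{(q−1)/2}`) has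
`N₀ + N_θ` elements (Schmidt I §4: "`|𝔖| = N₁ + N₀`", resp. "`= N₂ + N₀`").
[cite: Schmidt1976, Ch. I §4, p. 20] -/
theorem card_frakS (hq : Odd (Fintype.card F)) (f : F[X]) {θ : F} (hθ : θ ≠ 0) :
    (univ.filter fun x : F => f.eval x = 0 ∨ (f ^ ((Fintype.card F - 1) / 2)).eval x = θ).card =
      (univ.filter fun x : F => f.eval x = 0).card +
      (univ.filter fun x : F => f.eval x ≠ 0 ∧ f.eval x ^ (Fintype.card F / 2) = θ).card := by
  have he : (Fintype.card F - 1) / 2 = Fintype.card F / 2 := by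
    obtain ⟨k, hk⟩ := hq; omega
  have hepos : 0 < Fintype.card F / 2 := Nat.div_pos Fintype.one_lt_card two_pos
  rw [Finset.filter_or, Finset.card_union_of_disjoint]
  · congr 1
    refine congrArg Finset.card (Finset.filter_congr fun x _ => ?_)
    rw [eval_pow, he]
    constructor
    · intro h
      refine ⟨fun h0 => hθ ?_, h⟩
      rw [h0, zero_pow hepos.ne'] at h
      exact h.symm
    · exact fun h => h.2
  · rw [Finset.disjoint_filter]
    intro x _ h0 h
    rw [eval_pow, h0, zero_pow (by rw [he]; exact hepos.ne')] at h
    exact hθ h.symm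

/-! ### §4: the core estimate from the Fundamental lemma -/

/-- **Schmidt, Ch. I §4 (proof of Theorem 2A, `d = 2`), integer form:** if for `θ = 1` and
`θ = −1` there are polynomials `r_θ ≠ 0` of degree `≤ qM/2 + 4mq` vanishing to order `≥ M` on
`𝔖_θ` (Lemma 3B), then `|N − q|·M ≤ 8mq` — from `|𝔖_θ| M ≤ deg r_θ`, `N = N₀ + 2N₁`,
`q = N₀ + N₁ + N₂` ((4.1), (4.2)). [cite: Schmidt1976, Ch. I §4, pp. 19–20] -/
theorem abs_sub_mul_le_of_auxPolys (hq : Odd (Fintype.card F)) (f : F[X]) (M : ℕ)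
    (h3B : ∀ θ : F, (θ = 1 ∨ θ = -1) → ∃ r : F[X], r ≠ 0 ∧
      2 * r.natDegree ≤ Fintype.card F * M + 8 * f.natDegree * Fintype.card F ∧
      ∀ x : F, (f.eval x = 0 ∨ (f ^ ((Fintype.card F - 1) / 2)).eval x = θ) → (X - C x) ^ M ∣ r) :
    |(((univ.filter fun xy : F × F => xy.2 ^ 2 = f.eval xy.1).card : ℤ) - Fintype.card F)| * M ≤
      8 * f.natDegree * Fintype.card F := by
  have hF : ringChar F ≠ 2 := by
    intro h2
    have := FiniteField.even_card_of_char_two h2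
    obtain ⟨k, hk⟩ := hq
    omega
  -- notation
  set q := Fintype.card F with hqdef
  set N₀ := (univ.filter fun x : F => f.eval x = 0).card with hN₀
  set N₁ := (univ.filter fun x : F => f.eval x ≠ 0 ∧ f.eval x ^ (q / 2) = 1).card with hN₁
  set N₂ := (univ.filter fun x : F => f.eval x ≠ 0 ∧ f.eval x ^ (q / 2) = -1).card with hN₂
  have hN : ((univ.filter fun xy : F × F => xy.2 ^ 2 = f.eval xy.1).card : ℤ) = q + (N₁ - N₂ : ℤ) := by
    rw [card_solutions_eq hF f, sum_quadraticChar_eval_eq hF f]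
  have hpart : N₀ + N₁ + N₂ = q := card_classes_eq hF f
  -- the two applications of Lemma 3B
  have hS : ∀ θ : F, (θ = 1 ∨ θ = -1) →
      2 * ((N₀ + (univ.filter fun x : F => f.eval x ≠ 0 ∧ f.eval x ^ (q / 2) = θ).card) * M) ≤
        q * M + 8 * f.natDegree * q := by
    intro θ hθ
    have hθ0 : θ ≠ 0 := by
      rcases hθ with rfl | rfl
      · exact one_ne_zero
      · exact neg_ne_zero.mpr one_ne_zero
    obtain ⟨r, hr0, hrdeg, hrdvd⟩ := h3B θ hθ
    have hcard := card_mul_le_natDegree_of_pow_dvd hr0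
      (univ.filter fun x : F => f.eval x = 0 ∨ (f ^ ((Fintype.card F - 1) / 2)).eval x = θ)
      (fun x hx => hrdvd x (by rw [Finset.mem_filter] at hx; exact hx.2))
    rw [card_frakS hq f hθ0] at hcard
    calc 2 * ((N₀ + (univ.filter fun x : F => f.eval x ≠ 0 ∧ f.eval x ^ (q / 2) = θ).card) * M)
        ≤ 2 * r.natDegree := Nat.mul_le_mul_left 2 hcard
      _ ≤ q * M + 8 * f.natDegree * q := hrdeg
  have hS1 := hS 1 (Or.inl rfl)
  have hS2 := hS (-1) (Or.inr rfl)
  rw [← hN₁] at hS1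
  rw [← hN₂] at hS2
  rw [hN, add_sub_cancel_left]
  -- integer arithmetic
  have h1 : ((N₁ : ℤ) - N₂) * M ≤ 8 * f.natDegree * q := by
    have : (2 * ((N₀ + N₁) * M) : ℤ) ≤ q * M + 8 * f.natDegree * q := by exact_mod_cast hS1
    have hp : ((N₀ : ℤ) + N₁ + N₂) = q := by exact_mod_cast hpart
    nlinarith
  have h2 : ((N₂ : ℤ) - N₁) * M ≤ 8 * f.natDegree * q := by
    have : (2 * ((N₀ + N₂) * M) : ℤ) ≤ q * M + 8 * f.natDegree * q := by exact_mod_cast hS2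
    have hp : ((N₀ : ℤ) + N₁ + N₂) = q := by exact_mod_cast hpart
    nlinarith
  rcases le_or_gt (N₂ : ℤ) N₁ with hle | hlt
  · rw [abs_of_nonneg (by linarith)]
    exact h1
  · rw [abs_of_neg (by linarith), neg_sub]
    exact h2

/-! ### §4: the choice `M = [√q] − 3` and the real form of the estimate -/

/-- For `q ≥ 196` the choice `M = [√q] − 3` of §4 satisfies `M ≥ 1`, `(M + 3)² ≤ q` and `q ≤ 2M²`
("`M ≥ √(2q/d) − 4 ≥ √(q/d)`", p. 19). [cite: Schmidt1976, Ch. I §4, p. 19] -/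
theorem sqrt_sub_three_bounds {q : ℕ} (hq : 196 ≤ q) :
    1 ≤ Nat.sqrt q - 3 ∧ (Nat.sqrt q - 3) * (Nat.sqrt q - 3) + 6 * (Nat.sqrt q - 3) + 9 ≤ q ∧
      q ≤ 2 * ((Nat.sqrt q - 3) * (Nat.sqrt q - 3)) := by
  set s := Nat.sqrt q with hs
  have h1 : s * s ≤ q := Nat.sqrt_le q
  have h2 : q < (s + 1) * (s + 1) := Nat.lt_succ_sqrt q
  have hs14 : 14 ≤ s := by
    rw [hs, Nat.le_sqrt]; exact hq
  clear_value s
  obtain ⟨t, rfl⟩ : ∃ t, s = t + 3 := ⟨s - 3, by omega⟩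
  simp only [Nat.add_sub_cancel]
  refine ⟨by omega, by nlinarith, by nlinarith⟩

/-- From `|N − q|·M ≤ 8mq` with `q ≤ 2M²`: `|N − q| ≤ 8mq/M ≤ 8√2 m√q = 4·2^{3/2}·m·q^{1/2}`
("`|𝔖| ≤ (ε/d) q + 4q m/M`" and "`M ≥ √(q/d)`", p. 19–20).
[cite: Schmidt1976, Ch. I §4, pp. 19–20] -/
theorem real_bound_of_mul_le {N q m M : ℕ} (hM : 1 ≤ M) (hqM : q ≤ 2 * (M * M))
    (h : |((N : ℤ) - q)| * M ≤ 8 * m * q) :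
    |(N : ℝ) - q| ≤ 4 * (2 : ℝ) ^ ((3 : ℝ) / 2) * m * Real.sqrt q := by
  have hMpos : (0 : ℝ) < M := by exact_mod_cast hM
  have h' : |(N : ℝ) - q| * M ≤ 8 * m * q := by
    have := (Int.cast_le (R := ℝ)).mpr h
    push_cast at this
    exact this
  have hqM' : (q : ℝ) ≤ 2 * ((M : ℝ) * M) := by exact_mod_cast hqM
  -- `√q ≤ √2 · M`
  have hsqrt : Real.sqrt q ≤ Real.sqrt 2 * M := by
    rw [← Real.sqrt_mul_self hMpos.le, ← Real.sqrt_mul (by norm_num : (0:ℝ) ≤ 2)]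
    exact Real.sqrt_le_sqrt hqM'
  have h232 : (2 : ℝ) ^ ((3 : ℝ) / 2) = 2 * Real.sqrt 2 := by
    rw [show (3 : ℝ) / 2 = 1 + 1 / 2 by norm_num, Real.rpow_add two_pos, Real.rpow_one,
      Real.sqrt_eq_rpow]
  rw [h232]
  have hq0 : (0 : ℝ) ≤ q := Nat.cast_nonneg q
  -- `|N − q| ≤ 8 m q / M = 8 m √q (√q / M) ≤ 8 m √q √2`
  have key : |(N : ℝ) - q| * M ≤ (8 * Real.sqrt 2 * m * Real.sqrt q) * M := by
    calc |(N : ℝ) - q| * M ≤ 8 * m * q := h'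
      _ = 8 * m * (Real.sqrt q * Real.sqrt q) := by rw [Real.mul_self_sqrt hq0]
      _ ≤ 8 * m * (Real.sqrt q * (Real.sqrt 2 * M)) :=
          mul_le_mul_of_nonneg_left (mul_le_mul_of_nonneg_left hsqrt (Real.sqrt_nonneg _))
            (by positivity)
      _ = (8 * Real.sqrt 2 * m * Real.sqrt q) * M := by ring
  have := le_of_mul_le_mul_right key hMpos
  linarith

/-! ### Invariances of the count: `c f` and `f(X + c)`; characteristic `2` -/

/-- Scaling by a non-zero square does not change the number of solutions
(`y ↦ dy`, Lemma 2C (i) ⇒ (ii)). [cite: Schmidt1976, Ch. I §2, Lemma 2C, p. 12] -/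
theorem card_solutions_C_mul_sq (f : F[X]) {d : F} (hd : d ≠ 0) :
    (univ.filter fun xy : F × F => xy.2 ^ 2 = (C (d ^ 2) * f).eval xy.1).card =
      (univ.filter fun xy : F × F => xy.2 ^ 2 = f.eval xy.1).card := by
  symm
  refine Finset.card_bij (fun xy _ => (xy.1, d * xy.2)) ?_ ?_ ?_
  · rintro ⟨x, y⟩ hxy
    simp only [Finset.mem_filter, Finset.mem_univ, true_and] at hxy ⊢
    rw [eval_mul, eval_C, mul_pow, hxy]
  · rintro ⟨x, y⟩ _ ⟨x', y'⟩ _ h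
    simp only [Prod.mk.injEq] at h
    obtain ⟨rfl, h⟩ := h
    rw [mul_left_cancel₀ hd h]
  · rintro ⟨x, y⟩ hxy
    simp only [Finset.mem_filter, Finset.mem_univ, true_and] at hxy
    refine ⟨(x, d⁻¹ * y), ?_, ?_⟩
    · simp only [Finset.mem_filter, Finset.mem_univ, true_and]
      rw [eval_mul, eval_C] at hxy
      apply mul_left_cancel₀ (pow_ne_zero 2 hd)
      rw [← hxy]; field_simp
    · simp only [mul_inv_cancel_left₀ hd]

/-- Scaling by a non-square `c` replaces `N` by `2q − N` (`#{y : y² = ca} = 1 − χ(a)`), so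
`|N − q|` is unchanged (Schmidt I §2, heuristics before Theorem 2A, and Lemma 2C).
[cite: Schmidt1976, Ch. I §2, p. 11] -/
theorem card_solutions_C_mul_nonsquare (hF : ringChar F ≠ 2) (f : F[X]) {c : F}
    (hc : ¬ IsSquare c) :
    ((univ.filter fun xy : F × F => xy.2 ^ 2 = (C c * f).eval xy.1).card : ℤ) +
      (univ.filter fun xy : F × F => xy.2 ^ 2 = f.eval xy.1).card = 2 * Fintype.card F := by
  rw [card_solutions_eq hF, card_solutions_eq hF]
  have hχ : quadraticChar F c = -1 := quadraticChar_neg_one_iff_not_isSquare.mpr hc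
  have : ∀ x : F, quadraticChar F ((C c * f).eval x) = -quadraticChar F (f.eval x) := by
    intro x
    rw [eval_mul, eval_C, map_mul, hχ, neg_one_mul]
  simp_rw [this, Finset.sum_neg_distrib]
  ring

/-- Translating `x ↦ x + c` does not change the number of solutions (`h_i(X − c)` "is a
polynomial of the same type", §5 p. 22). [cite: Schmidt1976, Ch. I §5, p. 22] -/
theorem card_solutions_taylor (f : F[X]) (c : F) :
    (univ.filter fun xy : F × F => xy.2 ^ 2 = (taylor c f).eval xy.1).card =
      (univ.filter fun xy : F × F => xy.2 ^ 2 = f.eval xy.1).card := by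
  refine Finset.card_bij (fun xy _ => (xy.1 + c, xy.2)) ?_ ?_ ?_
  · rintro ⟨x, y⟩ hxy
    simp only [Finset.mem_filter, Finset.mem_univ, true_and] at hxy ⊢
    rwa [taylor_eval] at hxy
  · rintro ⟨x, y⟩ _ ⟨x', y'⟩ _ h
    simp only [Prod.mk.injEq, add_left_inj] at h
    rw [h.1, h.2]
  · rintro ⟨x, y⟩ hxy
    simp only [Finset.mem_filter, Finset.mem_univ, true_and] at hxy
    refine ⟨(x - c, y), ?_, ?_⟩
    · simp only [Finset.mem_filter, Finset.mem_univ, true_and]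
      rwa [taylor_eval, sub_add_cancel]
    · simp only [sub_add_cancel]

/-- In characteristic `2`, `y ↦ y²` is a bijection and `N = q` exactly ("If `q = 2^κ` … the
number of solutions of `y² = f(x)` is equal to … `q`", Schmidt I §2, p. 11).
[cite: Schmidt1976, Ch. I §2, p. 11] -/
theorem card_solutions_of_char_two (hF : ringChar F = 2) (f : F[X]) :
    (univ.filter fun xy : F × F => xy.2 ^ 2 = f.eval xy.1).card = Fintype.card F := by
  haveI : CharP F 2 := ringChar.of_eq hF
  have hinj : Function.Injective fun y : F => y ^ 2 := by
    have := frobenius_inj F 2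
    intro y₁ y₂ h
    exact this (by simpa [frobenius_def] using h)
  have hbij := Finite.injective_iff_bijective.mp hinj
  have hone : ∀ a : F, (univ.filter fun y : F => y ^ 2 = a).card = 1 := by
    intro a
    obtain ⟨y₀, hy₀⟩ := hbij.2 a
    rw [Finset.card_eq_one]
    refine ⟨y₀, ?_⟩
    ext y
    simp only [Finset.mem_filter, Finset.mem_univ, true_and, Finset.mem_singleton]
    constructor
    · intro hy; exact hinj (hy.trans hy₀.symm)
    · rintro rfl; exact hy₀
  rw [Finset.card_filter, Fintype.sum_prod_type]
  simp only
  have : ∀ x : F, (∑ y : F, if y ^ 2 = f.eval x then 1 else 0) = 1 := by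
    intro x; rw [← Finset.card_filter, hone]
  simp_rw [this, Finset.sum_const, Finset.card_univ, smul_eq_mul, mul_one]

/-! ### Theorem 2A (`d = 2`) from the Fundamental lemma -/

/-- **The core case of Theorem 2A (`d = 2`)**: `f` monic, `f(0) ≠ 0`, `q` odd (§4 with Lemma 3B
for `θ = ±1` and `M = [√q] − 3`). [cite: Schmidt1976, Ch. I §4, pp. 19–20] -/
theorem core_bound
    (H3B : ∀ ⦃f : F[X]⦄, f.Monic → Odd (Fintype.card F) → f.coeff 0 ≠ 0 →
      (¬ ∃ (c : F) (l : F[X]), f = C c * l ^ 2) → 1 ≤ f.natDegree →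
      2 * f.natDegree < Fintype.card F → f.natDegree * f.natDegree < Fintype.card F →
      ∀ ⦃M : ℕ⦄, 1 ≤ M → M * M + 6 * M + 9 ≤ Fintype.card F → ∀ θ : F,
        ∃ r : F[X], r ≠ 0 ∧
          2 * r.natDegree ≤ Fintype.card F * M + 8 * f.natDegree * Fintype.card F ∧
          ∀ x : F, (f.eval x = 0 ∨ (f ^ ((Fintype.card F - 1) / 2)).eval x = θ) →
            (X - C x) ^ M ∣ r)
    {f : F[X]} (hf : f.Monic) (hq : Odd (Fintype.card F))
    (hf0 : f.coeff 0 ≠ 0) (hnsq : ¬ ∃ (c : F) (l : F[X]), f = C c * l ^ 2) (hm1 : 1 ≤ f.natDegree)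
    (hmq : 200 * (f.natDegree * f.natDegree) < Fintype.card F) :
    |(((univ.filter fun xy : F × F => xy.2 ^ 2 = f.eval xy.1).card : ℝ)) - Fintype.card F| ≤
      4 * (2 : ℝ) ^ ((3 : ℝ) / 2) * f.natDegree * Real.sqrt (Fintype.card F) := by
  set q := Fintype.card F with hqdef
  set m := f.natDegree with hmdef
  have hq196 : 196 ≤ q := by nlinarith
  have h2m : 2 * m < q := by nlinarith
  have hmm : m * m < q := by nlinarith
  obtain ⟨hM1, hMq, hqM⟩ := sqrt_sub_three_bounds hq196
  have h := abs_sub_mul_le_of_auxPolys hq f (Nat.sqrt q - 3)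
    (fun θ _ => H3B hf hq hf0 hnsq hm1 h2m hmm hM1 hMq θ)
  have h' := real_bound_of_mul_le (N := (univ.filter fun xy : F × F => xy.2 ^ 2 = f.eval xy.1).card)
    hM1 hqM h
  exact_mod_cast h'

omit [Fintype F] [DecidableEq F] in
/-- A polynomial that is not `c·ℓ²` is non-zero of degree `≥ 1`. [folklore] -/
theorem one_le_natDegree_of_not_sq {f : F[X]} (hnsq : ¬ ∃ (c : F) (l : F[X]), f = C c * l ^ 2) :
    f ≠ 0 ∧ 1 ≤ f.natDegree := by
  constructor
  · rintro rfl
    exact hnsq ⟨0, 0, by simp⟩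
  · by_contra h
    push Not at h
    have h0 : f.natDegree = 0 := by omega
    exact hnsq ⟨f.coeff 0, 1, by rw [one_pow, mul_one]; exact eq_C_of_natDegree_eq_zero h0⟩

/-- **Schmidt, Ch. I, Theorem 2A for `d = 2` from Lemma 3B** — all reductions included: `q` even
(`N = q`), non-monic `f` (scale by the leading coefficient: a square does not change `N`, a
non-square replaces `N` by `2q − N`), `f(0) = 0` (translate by a non-root, `q > m`).
[cite: Schmidt1976, Ch. I §2, Theorem 2A, p. 11; §4, pp. 19–20; §5, p. 22] -/
theorem theorem_I_2A_two_of_lemma3B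
    (H3B : ∀ ⦃f : F[X]⦄, f.Monic → Odd (Fintype.card F) → f.coeff 0 ≠ 0 →
      (¬ ∃ (c : F) (l : F[X]), f = C c * l ^ 2) → 1 ≤ f.natDegree →
      2 * f.natDegree < Fintype.card F → f.natDegree * f.natDegree < Fintype.card F →
      ∀ ⦃M : ℕ⦄, 1 ≤ M → M * M + 6 * M + 9 ≤ Fintype.card F → ∀ θ : F,
        ∃ r : F[X], r ≠ 0 ∧
          2 * r.natDegree ≤ Fintype.card F * M + 8 * f.natDegree * Fintype.card F ∧
          ∀ x : F, (f.eval x = 0 ∨ (f ^ ((Fintype.card F - 1) / 2)).eval x = θ) →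
            (X - C x) ^ M ∣ r)
    (f : F[X])
    (hnsq : ¬ ∃ (c : F) (l : F[X]), f = C c * l ^ 2)
    (hq : 100 * 2 * (f.natDegree : ℝ) ^ 2 < Fintype.card F) :
    |(((univ.filter fun xy : F × F => xy.2 ^ 2 = f.eval xy.1).card : ℝ)) - Fintype.card F| ≤
      4 * (2 : ℝ) ^ ((3 : ℝ) / 2) * f.natDegree * Real.sqrt (Fintype.card F) := by
  obtain ⟨hf0, hm1⟩ := one_le_natDegree_of_not_sq hnsq
  set q := Fintype.card F with hqdef
  have hmq : 200 * (f.natDegree * f.natDegree) < q := by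
    have : ((200 * (f.natDegree * f.natDegree) : ℕ) : ℝ) < q := by push_cast; nlinarith
    exact_mod_cast this
  have hRHS : 0 ≤ 4 * (2 : ℝ) ^ ((3 : ℝ) / 2) * f.natDegree * Real.sqrt q := by positivity
  -- characteristic `2`
  by_cases hF : ringChar F = 2
  · rw [card_solutions_of_char_two hF, sub_self, abs_zero]
    exact hRHS
  have hodd : Odd q := Nat.odd_iff.mpr (FiniteField.odd_card_of_char_ne_two hF)
  -- reduce to a monic polynomial
  set c := f.leadingCoeff with hcdef
  have hc : c ≠ 0 := leadingCoeff_ne_zero.mpr hf0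
  set f₁ := C c⁻¹ * f with hf₁def
  have hf₁m : f₁.Monic := monic_C_mul_of_mul_leadingCoeff_eq_one (inv_mul_cancel₀ hc)
  have hff₁ : f = C c * f₁ := by
    rw [hf₁def, ← mul_assoc, ← C_mul, mul_inv_cancel₀ hc, C_1, one_mul]
  have hdeg₁ : f₁.natDegree = f.natDegree := natDegree_C_mul (inv_ne_zero hc)
  have hnsq₁ : ¬ ∃ (a : F) (l : F[X]), f₁ = C a * l ^ 2 := by
    rintro ⟨a, l, h⟩
    exact hnsq ⟨c * a, l, by rw [hff₁, h, ← mul_assoc, ← C_mul]⟩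
  have habs₁ : |(((univ.filter fun xy : F × F => xy.2 ^ 2 = f.eval xy.1).card : ℝ)) - q| =
      |(((univ.filter fun xy : F × F => xy.2 ^ 2 = f₁.eval xy.1).card : ℝ)) - q| := by
    by_cases hsq : IsSquare c
    · obtain ⟨d, hd⟩ := hsq
      have hd0 : d ≠ 0 := by rintro rfl; exact hc (by rw [hd, mul_zero])
      rw [hff₁, hd, ← sq, card_solutions_C_mul_sq f₁ hd0]
    · have h2 := card_solutions_C_mul_nonsquare hF f₁ hsq
      rw [← hff₁] at h2
      have h2' : (((univ.filter fun xy : F × F => xy.2 ^ 2 = f.eval xy.1).card : ℝ)) =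
          2 * q - ((univ.filter fun xy : F × F => xy.2 ^ 2 = f₁.eval xy.1).card : ℝ) := by
        have := congrArg (fun z : ℤ => (z : ℝ)) h2
        push_cast at this
        linarith
      rw [h2', show (2 * (q : ℝ) - _ - q) = -((((univ.filter fun xy : F × F =>
        xy.2 ^ 2 = f₁.eval xy.1).card : ℝ)) - q) by ring, abs_neg]
  rw [habs₁, ← hdeg₁]
  rw [← hdeg₁] at hmq hm1
  -- reduce to `f₁(0) ≠ 0` by a translation
  have hex : ∃ a : F, f₁.eval a ≠ 0 := by
    by_contra hall
    push Not at hall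
    have : f₁ = 0 := eq_zero_of_natDegree_lt_card_of_eval_eq_zero f₁ Function.injective_id hall
      (by nlinarith)
    exact hf₁m.ne_zero this
  obtain ⟨a, ha⟩ := hex
  set f₂ := taylor a f₁ with hf₂def
  have hf₂m : f₂.Monic := by
    rw [Monic, hf₂def, leadingCoeff_taylor]; exact hf₁m
  have hdeg₂ : f₂.natDegree = f₁.natDegree := natDegree_taylor _ _
  have hf₂0 : f₂.coeff 0 ≠ 0 := by rwa [hf₂def, taylor_coeff_zero]
  have hnsq₂ : ¬ ∃ (b : F) (l : F[X]), f₂ = C b * l ^ 2 := by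
    rintro ⟨b, l, h⟩
    apply hnsq₁
    refine ⟨b, taylor (-a) l, ?_⟩
    have := congrArg (taylor (-a)) h
    rwa [hf₂def, taylor_taylor, neg_add_cancel, taylor_zero, taylor_mul, taylor_C,
      taylor_pow] at this
  rw [← card_solutions_taylor f₁ a, ← hdeg₂]
  rw [← hdeg₂] at hmq hm1
  exact core_bound H3B hf₂m hodd hf₂0 hnsq₂ hm1 hmq

end Stepanov

end Literature.NumberTheory.LFunctions
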